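import Literature.Computability.AlgebraicComplexity.BI17GenericMinimalDegreeProofs
import Literature.Computability.AlgebraicComplexity.BI17GenericDegreeMonoidProofs
import Literature.Computability.AlgebraicComplexity.BI17OddPlethysmColumnSets
import Literature.Computability.AlgebraicComplexity.BI17OddCayleyInvariantProofs
import Literature.Computability.AlgebraicComplexity.DIP20MonomialCountDP
import Literature.NumberTheory.DiophantineGeometry.SchurWeylPlethysmOrbitWeightsProofs
import HarnessLib

/-!
# BI 2017, Example 3.7: the generic degree monoids `E(3,3)`, `E(4,4)` — the exclusions, the
# minimal degrees `e(3,3) = e(4,4) = 4`, and `E(4,4) ⊆ ℕ ∖ {1,2,3,5,9}`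

Topic `Literature/Computability/AlgebraicComplexity`; theorems only (no definitions, no named
facts). Companion of `BI17FundamentalInvariantForms.lean` (val-lit-t04), towards its named fact
`BI2017_ex_3_7` — P. Bürgisser, C. Ikenmeyer, *Fundamental invariants of orbit closures*,
J. Algebra 477 (2017) 390–434 = arXiv:1511.02927, Example 3.7 (main.tex L823): "`E(2,2) = 2ℕ`",
"`E(3,3) = 2(ℕ ∖ {1})` and hence `e(3,3) = 4`", "`E(4,4) = {0,4,6,7,8,10,11,…}`, so the gaps are
`1,2,3,5,9` and we have `e(4,4) = 4`" (in print: "computed with the SCHUR package").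

The tree's `genericDegreeMonoid σ k D = {d | ∃ F ≠ 0 homogeneous of degree d, SL-invariant}` is
the set of degrees `d` with `O(Sym^D k^σ)^{SL}_d ≠ 0` (`slInvariantsOfDegree σ k D d ≠ ⊥`,
`mem_genericDegreeMonoid_iff_ne_bot`). This file proves, WITHOUT SCHUR:

* §1 `finrank_slInvariantsOfDegree_le_plethysmCoeff`: `dim O(Sym^D ℂ^m)^{SL_m}_d ≤ a_{(s^m)}(d[D])`
  (`s = Dd/m`), since an invariant is a highest-weight vector of the rectangular weight
  (`slInvariantsOfDegree_le_highestWeightSpace`, val-lit-t01) and the plethysm coefficient IS the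
  dimension of that highest-weight space (`plethysmCoeff`, `hwMultiplicity`); hence a vanishing
  plethysm coefficient excludes the degree (`not_mem_genericDegreeMonoid_of_plethysmCoeff_eq_zero`).
* §2 the two KERNEL plethysm zeros `a_{(5,5,5,5)}(5[4]) = 0`, `a_{(9,9,9,9)}(9[4]) = 0` (DIP 2020
  eq. (4.4) over ONE packed table of the monomial counts, `plethysmCoeff_fin_four_cast_eq_dp`,
  val-lit-p4 g3; `decide +kernel`, no `native_decide`) — so `5, 9 ∉ E(4,4)`; with Howe's theorem
  (`slInvariantsOfDegree_eq_bot_of_lt`, `d < m`) `1, 2, 3 ∉ E(4,4)` and `1, 2 ∉ E(3,3)`, and with its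
  odd case (`slInvariantsOfDegree_self_eq_bot_of_odd`) `3 ∉ E(3,3)`: **`E(4,4) ⊆ ℕ ∖ {1,2,3,5,9}`**.
* §3 `4 ∈ E(3,3)` (Aronhold's invariant `S` of ternary cubics, here as BI's invariant `P_3` of the
  cyclic `3 × 4` tableau, eq. (3.7): `oddCayleyP_ne_zero_of_odd`, val-lit-t04, and
  `tableauInvPoly_mem_slInvariantsOfDegree`, val-lit-t01) and `4 ∈ E(4,4)` (Cayley's `P_{4,4}`,
  `mem_genericDegreeMonoid_self_of_even`); hence **`e(3,3) = 4`** and **`e(4,4) = 4`**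
  (`genericMinimalDegree_three_three`, `genericMinimalDegree_four_four`).
* §4 the numerical semigroup `⟨4, 6, 7⟩ = ℕ ∖ {1,2,3,5,9}` and the reduction
  `genericDegreeMonoid_four_four_of_mem`: `E(4,4) = ℕ ∖ {1,2,3,5,9}` as soon as `6, 7 ∈ E(4,4)`
  (the two nonvanishing certificates are the business of a sibling file).

The desk check of the typing seat and an independent evaluation of DIP (4.4) (this seat,
`scratch/pleth.py`) give `dim O(Sym^4 ℂ^4)^{SL_4}_d = 0,0,0,1,0,1,1,3,0,5,2,11` for `d = 1,…,12` and
`dim O(Sym^3 ℂ^3)^{SL_3}_d = [t^d] 1/((1-t^4)(1-t^6))`, in agreement with the printed example.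

HONEST FRAMING (cell `val-lit`, rung V3, row BI17): classical invariant theory of ternary cubics and
quaternary quartics as typed-fact bookkeeping; nothing here bears on permanent versus determinant;
VP ≠ VNP is NOT proved and nothing in this file is progress on it.

## References
* [BurgisserIkenmeyer2017] P. Bürgisser, C. Ikenmeyer, J. Algebra 477 (2017), Ex. 3.7 (main.tex
  L823), Def. 3.6 (L804), Thm. 3.14 (Howe), Thm. 3.18, eq. (3.7) / Thm. 3.22.
* [DorflerIkenmeyerPanova2020] J. Dörfler, C. Ikenmeyer, G. Panova, SIAM J. Appl. Algebra Geom. 4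
  (2020), eqs. (4.3)–(4.4) (the monomial-count formula behind the kernel values).

## Tree
`genericDegreeMonoid`, `genericMinimalDegree`, `slInvariantsOfDegree`, `mem_slInvariantsOfDegree_iff`
(`BI17FundamentalInvariantForms`); `slInvariantsOfDegree_eq_bot_of_lt`,
`slInvariantsOfDegree_self_eq_bot_of_odd` (`BI17HoweInvariantsProofs`);
`mem_genericDegreeMonoid_self_of_even` (`BI17GenericMinimalDegreeProofs`);
`zero_mem_genericDegreeMonoid`, `add_mem_genericDegreeMonoid` (`BI17GenericDegreeMonoidProofs`);
`slInvariantsOfDegree_le_highestWeightSpace` (`BI17OddPlethysmColumnSets`);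
`oddCayleyP_ne_zero_of_odd` (`BI17OddCayleyInvariantProofs`); `tableauInvPoly_mem_slInvariantsOfDegree`
(`BI17PowerSumDegreeProofs`); `plethysmCoeff_fin_four_cast_eq_dp`, `weakComps`, `dpTables`, `digitAt`,
`flat3` (`DIP20MonomialCountDP`, `DIP20MonomialCounts`); `plethysmCoeff`, `hwMultiplicity`, `rowDual`,
`finiteDimensional_highestWeightSpace_coordRep_holds` (`SchurWeylPlethysm`, `GLHighestWeight`,
`DIP20MultiplicityObstructions`, `SchurWeylPlethysmOrbitWeightsProofs`).

Provenance: val-lit cell, prover val-lit-p4 g4 (registry claim #1 on `BI2017_ex_3_7`).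
-/

namespace Literature.Computability.AlgebraicComplexity

open MvPolynomial
open _root_.Literature.NumberTheory.DiophantineGeometry

/-! ### §1 Degrees, invariants and the rectangular plethysm coefficient -/

section General

variable {σ k : Type*} [Fintype σ] [DecidableEq σ] [Field k]

/-- `d ∈ E(D,m)` iff `O(Sym^D)^{SL}_d ≠ 0` (BI 2017 Def. 3.6, L804: "`E(D,m) := {d ∈ ℕ |
O(Sym^D ℂ^m)^{SL_m}_d ≠ 0}`"). [cite: BurgisserIkenmeyer2017, Def. 3.6] -/
theorem mem_genericDegreeMonoid_iff_ne_bot {D d : ℕ} :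
    d ∈ genericDegreeMonoid σ k D ↔ slInvariantsOfDegree σ k D d ≠ ⊥ := by
  rw [Submodule.ne_bot_iff]
  constructor
  · rintro ⟨F, hFh, hFi, hF0⟩
    exact ⟨F, (mem_slInvariantsOfDegree_iff D d F).mpr ⟨hFh, hFi⟩, hF0⟩
  · rintro ⟨F, hF, hF0⟩
    obtain ⟨hFh, hFi⟩ := (mem_slInvariantsOfDegree_iff D d F).mp hF
    exact ⟨F, hFh, hFi, hF0⟩

/-- A degree carrying a nonzero element of `O(Sym^D)^{SL}_d` lies in `E(D,m)`.
[cite: BurgisserIkenmeyer2017, Def. 3.6] -/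
theorem mem_genericDegreeMonoid_of_mem_of_ne_zero {D d : ℕ} {F : MvPolynomial (DegIdx σ D) k}
    (hF : F ∈ slInvariantsOfDegree σ k D d) (hF0 : F ≠ 0) : d ∈ genericDegreeMonoid σ k D :=
  mem_genericDegreeMonoid_iff_ne_bot.mpr ((Submodule.ne_bot_iff _).mpr ⟨F, hF, hF0⟩)

end General

section Plethysm

variable {m D d : ℕ}

/-- **`dim O(Sym^D ℂ^m)^{SL_m}_d ≤ a_{(s^m)}(d[D])`, `s = Dd/m`** (`m ∣ Dd`, `D ≥ 1`): an `SL_m`-invariant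
of degree `d` is a highest-weight vector of the constant weight `-(Dd/m)` (BI 2017 Rem. 3.13 /
App. Cor. 7.2 set-up; tree `slInvariantsOfDegree_le_highestWeightSpace`), and the plethysm
coefficient of that weight is by definition the dimension of the highest-weight space, which is
finite-dimensional for `D ≠ 0` (`finiteDimensional_highestWeightSpace_coordRep_holds`).
[cite: BurgisserIkenmeyer2017, Rem. 3.13] -/
theorem finrank_slInvariantsOfDegree_le_plethysmCoeff (hm : 0 < m) (hD : 0 < D) (hdvd : m ∣ D * d) :
    Module.finrank ℂ (slInvariantsOfDegree (Fin m) ℂ D d) ≤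
      plethysmCoeff ℂ (Fin m) D (fun _ : Fin m => -((D * d / m : ℕ) : ℤ)) := by
  haveI : FiniteDimensional ℂ
      (highestWeightSpace (coordRep (Fin m) ℂ D) (fun _ : Fin m => -((D * d / m : ℕ) : ℤ))) :=
    finiteDimensional_highestWeightSpace_coordRep_holds hD.ne' _
  exact Submodule.finrank_mono (slInvariantsOfDegree_le_highestWeightSpace hm hdvd)

/-- Hence **a vanishing rectangular plethysm coefficient excludes the degree**:
`a_{(s^m)}(d[D]) = 0 ⇒ d ∉ E(D,m)`. [cite: BurgisserIkenmeyer2017, Rem. 3.13] -/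
theorem not_mem_genericDegreeMonoid_of_plethysmCoeff_eq_zero (hm : 0 < m) (hD : 0 < D)
    (hdvd : m ∣ D * d)
    (h0 : plethysmCoeff ℂ (Fin m) D (fun _ : Fin m => -((D * d / m : ℕ) : ℤ)) = 0) :
    d ∉ genericDegreeMonoid (Fin m) ℂ D := by
  rw [mem_genericDegreeMonoid_iff_ne_bot, not_not]
  haveI : FiniteDimensional ℂ
      (highestWeightSpace (coordRep (Fin m) ℂ D) (fun _ : Fin m => -((D * d / m : ℕ) : ℤ))) :=
    finiteDimensional_highestWeightSpace_coordRep_holds hD.ne' _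
  haveI : FiniteDimensional ℂ (slInvariantsOfDegree (Fin m) ℂ D d) :=
    Submodule.finiteDimensional_of_le (slInvariantsOfDegree_le_highestWeightSpace hm hdvd)
  have hle := finrank_slInvariantsOfDegree_le_plethysmCoeff hm hD hdvd
  rw [h0, Nat.le_zero] at hle
  exact Submodule.finrank_eq_zero.mp hle

/-- Degrees `0 < d < m` are not in `E(D,m)` (`D ≥ 1`): Howe's theorem, BI 2017 Thm. 3.14
(`slInvariantsOfDegree_eq_bot_of_lt`). [cite: BurgisserIkenmeyer2017, Thm. 3.14] -/
theorem not_mem_genericDegreeMonoid_of_lt (hD : 0 < D) (hd : 0 < d) (hdm : d < m) :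
    d ∉ genericDegreeMonoid (Fin m) ℂ D := by
  rw [mem_genericDegreeMonoid_iff_ne_bot, not_not]
  exact slInvariantsOfDegree_eq_bot_of_lt (k := ℂ) hD hd hdm

/-- The degree `m` is not in `E(D,m)` for odd `D` (`m ≥ 2`): Howe's theorem, odd case
(`slInvariantsOfDegree_self_eq_bot_of_odd`). [cite: BurgisserIkenmeyer2017, Thm. 3.14] -/
theorem self_not_mem_genericDegreeMonoid_of_odd (hD : Odd D) (hm : 2 ≤ m) :
    m ∉ genericDegreeMonoid (Fin m) ℂ D := by
  rw [mem_genericDegreeMonoid_iff_ne_bot, not_not]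
  exact slInvariantsOfDegree_self_eq_bot_of_odd (k := ℂ) hD hm

/-- The constant weight `-(s)` is `rowDual` of the constant row vector `(s,…,s)` (DIP's convention
`λ^* = (-λ_m,…,-λ_1)` for the rectangle `λ = (s^m)`). [cite: DorflerIkenmeyerPanova2020, §2 (arXiv p. 3)] -/
theorem rowDual_const (m s : ℕ) : rowDual (fun _ : Fin m => s) = fun _ : Fin m => -(s : ℤ) := by
  funext i
  simp [rowDual, Weight.dual]

end Plethysm

/-! ### §2 Two kernel plethysm zeros and the exclusions for `E(4,4)`, `E(3,3)` -/

section KernelZeros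

/-- **`a_{(5,5,5,5)}(5[4]) = 0`**: `Sym^5(Sym^4 ℂ^4)` has no `SL_4`-invariant, i.e. quaternary quartics
have no invariant of degree `5` (BI 2017 Ex. 3.7: "the gaps are `1,2,3,5,9`"). By DIP (4.4) over one
packed table of the monomial counts `c_ν(5,4)` (`plethysmCoeff_fin_four_cast_eq_dp`, digit width
`26`: `36^5 < 2^26`), `decide +kernel`. [cite: BurgisserIkenmeyer2017, Ex. 3.7] -/
theorem plethysmCoeff_rowDual_five_five_five_five_four :
    plethysmCoeff ℂ (Fin 4) 4 (rowDual ![5, 5, 5, 5]) = 0 := by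
  have h := plethysmCoeff_fin_four_cast_eq_dp ![5, 5, 5, 5] (n := 4) (d := 5) (F := 26)
    (by norm_num) (by decide) (by decide) (by decide) (by rw [Fin.sum_univ_four]; rfl) (by decide)
    (by decide +kernel)
  have h2 : (plethysmCoeff ℂ (Fin 4) 4 (rowDual ![5, 5, 5, 5]) : ℤ) = 0 := by
    rw [h]
    decide +kernel
  exact_mod_cast h2

/-- **`a_{(9,9,9,9)}(9[4]) = 0`**: quaternary quartics have no invariant of degree `9` (BI 2017
Ex. 3.7: "the gaps are `1,2,3,5,9`"). By DIP (4.4) over one packed table of the `c_ν(9,4)`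
(`plethysmCoeff_fin_four_cast_eq_dp`, digit width `47`: `36^9 < 2^47`), `decide +kernel`.
[cite: BurgisserIkenmeyer2017, Ex. 3.7] -/
theorem plethysmCoeff_rowDual_nine_nine_nine_nine_four :
    plethysmCoeff ℂ (Fin 4) 4 (rowDual ![9, 9, 9, 9]) = 0 := by
  have h := plethysmCoeff_fin_four_cast_eq_dp ![9, 9, 9, 9] (n := 4) (d := 9) (F := 47)
    (by norm_num) (by decide) (by decide) (by decide) (by rw [Fin.sum_univ_four]; rfl) (by decide)
    (by decide +kernel)
  have h2 : (plethysmCoeff ℂ (Fin 4) 4 (rowDual ![9, 9, 9, 9]) : ℤ) = 0 := by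
    rw [h]
    decide +kernel
  exact_mod_cast h2

/-- `5 ∉ E(4,4)`. [cite: BurgisserIkenmeyer2017, Ex. 3.7] -/
theorem five_not_mem_genericDegreeMonoid_four_four : 5 ∉ genericDegreeMonoid (Fin 4) ℂ 4 := by
  refine not_mem_genericDegreeMonoid_of_plethysmCoeff_eq_zero (by norm_num) (by norm_num)
    ⟨5, by norm_num⟩ ?_
  have h : (fun _ : Fin 4 => -((4 * 5 / 4 : ℕ) : ℤ)) = rowDual ![5, 5, 5, 5] := by
    funext i
    fin_cases i <;> simp [rowDual, Weight.dual]
  rw [h]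
  exact plethysmCoeff_rowDual_five_five_five_five_four

/-- `9 ∉ E(4,4)`. [cite: BurgisserIkenmeyer2017, Ex. 3.7] -/
theorem nine_not_mem_genericDegreeMonoid_four_four : 9 ∉ genericDegreeMonoid (Fin 4) ℂ 4 := by
  refine not_mem_genericDegreeMonoid_of_plethysmCoeff_eq_zero (by norm_num) (by norm_num)
    ⟨9, by norm_num⟩ ?_
  have h : (fun _ : Fin 4 => -((4 * 9 / 4 : ℕ) : ℤ)) = rowDual ![9, 9, 9, 9] := by
    funext i
    fin_cases i <;> simp [rowDual, Weight.dual]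
  rw [h]
  exact plethysmCoeff_rowDual_nine_nine_nine_nine_four

/-- **`E(4,4) ⊆ ℕ ∖ {1,2,3,5,9}`** (BI 2017 Ex. 3.7: "the gaps are `1,2,3,5,9`"): `1,2,3` by Howe's
theorem (`d < m = 4`), `5, 9` by the two kernel plethysm zeros. [cite: BurgisserIkenmeyer2017, Ex. 3.7] -/
theorem genericDegreeMonoid_four_four_subset :
    genericDegreeMonoid (Fin 4) ℂ 4 ⊆ {d | d ≠ 1 ∧ d ≠ 2 ∧ d ≠ 3 ∧ d ≠ 5 ∧ d ≠ 9} := by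
  intro d hd
  refine ⟨?_, ?_, ?_, ?_, ?_⟩ <;> rintro rfl
  · exact not_mem_genericDegreeMonoid_of_lt (by norm_num) (by norm_num) (by norm_num) hd
  · exact not_mem_genericDegreeMonoid_of_lt (by norm_num) (by norm_num) (by norm_num) hd
  · exact not_mem_genericDegreeMonoid_of_lt (by norm_num) (by norm_num) (by norm_num) hd
  · exact five_not_mem_genericDegreeMonoid_four_four hd
  · exact nine_not_mem_genericDegreeMonoid_four_four hd

/-- `1, 2, 3 ∉ E(3,3)`: `1, 2` by Howe's theorem (`d < m = 3`), `3` by its odd case (`D = 3` odd,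
`d = m`). (BI 2017 Ex. 3.7: "`E(3,3) = 2(ℕ ∖ {1})`".) [cite: BurgisserIkenmeyer2017, Ex. 3.7] -/
theorem not_mem_genericDegreeMonoid_three_three_of_le_three {d : ℕ} (hd : 0 < d) (hd3 : d ≤ 3) :
    d ∉ genericDegreeMonoid (Fin 3) ℂ 3 := by
  rcases Nat.lt_or_ge d 3 with h | h
  · exact not_mem_genericDegreeMonoid_of_lt (by norm_num) hd h
  · have : d = 3 := le_antisymm hd3 h
    subst this
    exact self_not_mem_genericDegreeMonoid_of_odd (by decide) (by norm_num)

end KernelZeros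

/-! ### §3 `4 ∈ E(3,3)`, `4 ∈ E(4,4)` and the minimal degrees `e(3,3) = e(4,4) = 4` -/

section MinimalDegrees

/-- **`4 ∈ E(3,3)`**: ternary cubics have a nonzero invariant of degree `4` (Aronhold's `S`; here
BI's `P_3`, the tableau invariant of the cyclic `3 × 4` tableau, eq. (3.7), nonzero for odd `D = 3`
by Thm. 3.22 (2) — `oddCayleyP_ne_zero_of_odd` — and `SL_3`-invariant homogeneous of degree `4` by
Thm. 3.11 — `tableauInvPoly_mem_slInvariantsOfDegree`). [cite: BurgisserIkenmeyer2017, Ex. 3.7] -/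
theorem four_mem_genericDegreeMonoid_three_three : 4 ∈ genericDegreeMonoid (Fin 3) ℂ 3 := by
  have hP : oddCayleyP (k := ℂ) 3 (Equiv.refl (Fin 3)) ∈ slInvariantsOfDegree (Fin 3) ℂ 3 (3 + 1) :=
    tableauInvPoly_mem_slInvariantsOfDegree (k := ℂ) (cyclicTableau 3)
  exact mem_genericDegreeMonoid_of_mem_of_ne_zero hP (oddCayleyP_ne_zero_of_odd (by decide))

/-- **`4 ∈ E(4,4)`**: Cayley's invariant `P_{4,4}` of quaternary quartics (Thm. 3.18; tree
`mem_genericDegreeMonoid_self_of_even`). [cite: BurgisserIkenmeyer2017, Ex. 3.7] -/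
theorem four_mem_genericDegreeMonoid_four_four : 4 ∈ genericDegreeMonoid (Fin 4) ℂ 4 :=
  mem_genericDegreeMonoid_self_of_even (by decide) (by norm_num) (by norm_num)

/-- The minimal positive element of a set of naturals containing `4` and no `d` with `0 < d < 4` is
`4`. [folklore] -/
private theorem sInf_pos_eq_four {S : Set ℕ} (h4 : 4 ∈ S) (hlt : ∀ d, 0 < d → d < 4 → d ∉ S) :
    sInf {d | d ∈ S ∧ 0 < d} = 4 := by
  have hmem : 4 ∈ {d | d ∈ S ∧ 0 < d} := ⟨h4, by norm_num⟩
  refine le_antisymm (Nat.sInf_le hmem) ?_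
  by_contra hlt4
  push Not at hlt4
  have hne : ({d | d ∈ S ∧ 0 < d} : Set ℕ).Nonempty := ⟨4, hmem⟩
  obtain ⟨hS, hpos⟩ := Nat.sInf_mem hne
  exact hlt _ hpos hlt4 hS

/-- **`e(3,3) = 4`** (BI 2017 Ex. 3.7: "and hence `e(3,3) = 4`"). [cite: BurgisserIkenmeyer2017, Ex. 3.7] -/
theorem genericMinimalDegree_three_three : genericMinimalDegree (Fin 3) ℂ 3 = 4 :=
  sInf_pos_eq_four four_mem_genericDegreeMonoid_three_three fun d hd hd4 =>
    not_mem_genericDegreeMonoid_three_three_of_le_three hd (by omega)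

/-- **`e(4,4) = 4`** (BI 2017 Ex. 3.7: "we have `e(4,4) = 4`"). [cite: BurgisserIkenmeyer2017, Ex. 3.7] -/
theorem genericMinimalDegree_four_four : genericMinimalDegree (Fin 4) ℂ 4 = 4 :=
  sInf_pos_eq_four four_mem_genericDegreeMonoid_four_four fun d hd hd4 =>
    not_mem_genericDegreeMonoid_of_lt (by norm_num) hd hd4

end MinimalDegrees

/-! ### §4 The numerical semigroup `⟨4,6,7⟩` and the reduction of `E(4,4)` to two certificates -/

section Semigroup

/-- The numerical semigroup generated by `4, 6, 7` is `ℕ ∖ {1,2,3,5,9}`: every `d ∉ {1,2,3,5,9}` is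
`4a + 6b + 7c` (`d = 0,4,6,7,8`; `10 = 4+6`, `11 = 4+7`, `12`, `13 = 6+7`, and `d ≥ 14` by `d - 4`).
[folklore] -/
private theorem exists_eq_four_six_seven_of_not_gap {d : ℕ}
    (hd : d ≠ 1 ∧ d ≠ 2 ∧ d ≠ 3 ∧ d ≠ 5 ∧ d ≠ 9) : ∃ a b c : ℕ, d = 4 * a + 6 * b + 7 * c := by
  obtain ⟨h1, h2, h3, h5, h9⟩ := hd
  induction d using Nat.strong_induction_on with
  | _ d ih =>
    by_cases h14 : d < 14
    · interval_cases d
      all_goals first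
        | exact absurd rfl h1 | exact absurd rfl h2 | exact absurd rfl h3 | exact absurd rfl h5
        | exact absurd rfl h9
        | exact ⟨0, 0, 0, rfl⟩ | exact ⟨1, 0, 0, rfl⟩ | exact ⟨0, 1, 0, rfl⟩ | exact ⟨0, 0, 1, rfl⟩
        | exact ⟨2, 0, 0, rfl⟩ | exact ⟨1, 1, 0, rfl⟩ | exact ⟨1, 0, 1, rfl⟩ | exact ⟨3, 0, 0, rfl⟩
        | exact ⟨0, 1, 1, rfl⟩
    · obtain ⟨a, b, c, h⟩ := ih (d - 4) (by omega) (by omega) (by omega) (by omega) (by omega)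
        (by omega)
      exact ⟨a + 1, b, c, by omega⟩

/-- Multiples and sums of members of `E(D,m)` are members (it is a submonoid of `ℕ`:
`zero_mem_genericDegreeMonoid`, `add_mem_genericDegreeMonoid`). [cite: BurgisserIkenmeyer2017, Def. 3.6] -/
theorem linComb_mem_genericDegreeMonoid {σ k : Type*} [Fintype σ] [DecidableEq σ] [Field k] {D : ℕ}
    {x y z : ℕ} (hx : x ∈ genericDegreeMonoid σ k D) (hy : y ∈ genericDegreeMonoid σ k D)
    (hz : z ∈ genericDegreeMonoid σ k D) (a b c : ℕ) :
    x * a + y * b + z * c ∈ genericDegreeMonoid σ k D := by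
  have hmul : ∀ {w : ℕ}, w ∈ genericDegreeMonoid σ k D → ∀ n : ℕ, w * n ∈ genericDegreeMonoid σ k D := by
    intro w hw n
    induction n with
    | zero => simpa using (zero_mem_genericDegreeMonoid (σ := σ) (k := k) (D := D))
    | succ n ih =>
      rw [Nat.mul_succ]
      exact add_mem_genericDegreeMonoid ih hw
  exact add_mem_genericDegreeMonoid (add_mem_genericDegreeMonoid (hmul hx a) (hmul hy b)) (hmul hz c)

/-- **Reduction of `E(4,4)`**: if `6 ∈ E(4,4)` and `7 ∈ E(4,4)` then
`E(4,4) = ℕ ∖ {1,2,3,5,9}` (`4 ∈ E(4,4)` by Cayley's `P_{4,4}`, sums by the monoid property, the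
exclusions by §2). [cite: BurgisserIkenmeyer2017, Ex. 3.7] -/
theorem genericDegreeMonoid_four_four_of_mem (h6 : 6 ∈ genericDegreeMonoid (Fin 4) ℂ 4)
    (h7 : 7 ∈ genericDegreeMonoid (Fin 4) ℂ 4) :
    genericDegreeMonoid (Fin 4) ℂ 4 = {d | d ≠ 1 ∧ d ≠ 2 ∧ d ≠ 3 ∧ d ≠ 5 ∧ d ≠ 9} := by
  refine Set.Subset.antisymm genericDegreeMonoid_four_four_subset fun d hd => ?_
  obtain ⟨a, b, c, rfl⟩ := exists_eq_four_six_seven_of_not_gap hd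
  exact linComb_mem_genericDegreeMonoid four_mem_genericDegreeMonoid_four_four h6 h7 a b c

/-- **Reduction of `E(3,3) ⊇ 2(ℕ ∖ {1})`**: if `6 ∈ E(3,3)` then every even `d ≠ 2` lies in `E(3,3)`
(`0`, and `d = 4a + 6b` for even `d ≥ 4`, with `4 ∈ E(3,3)` by §3). [cite: BurgisserIkenmeyer2017, Ex. 3.7] -/
theorem mem_genericDegreeMonoid_three_three_of_even (h6 : 6 ∈ genericDegreeMonoid (Fin 3) ℂ 3) {d : ℕ}
    (hd : Even d) (hd2 : d ≠ 2) : d ∈ genericDegreeMonoid (Fin 3) ℂ 3 := by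
  obtain ⟨a, b, h⟩ : ∃ a b : ℕ, d = 4 * a + 6 * b := by
    obtain ⟨j, rfl⟩ := hd
    rcases Nat.even_or_odd j with ⟨i, rfl⟩ | ⟨i, rfl⟩
    · exact ⟨i, 0, by omega⟩
    · rcases i with _ | i
      · exact absurd rfl hd2
      · exact ⟨i, 1, by omega⟩
  rw [h]
  have := linComb_mem_genericDegreeMonoid four_mem_genericDegreeMonoid_three_three h6
    (zero_mem_genericDegreeMonoid (σ := Fin 3) (k := ℂ) (D := 3)) a b 0
  simpa using this

end Semigroup

end Literature.Computability.AlgebraicComplexity
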